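import Mathlib
import Summits.Ventures.PercRepro2.SwOutBridge
import Summits.Ventures.PercRepro2.SwAllHMarkThm

/-!
# Two instances of the H-mark step (blind cell PercRepro2, night-4 g30, 2026-08-28;
proofs/NIGHT4-G30.md)

* `ex6h` (`Fin 6`, 8 edges; `l = 0`, `h = 1`, `o = 2`): the mark is joined to `l` and to `h` only;
  the vertices `3, 4` are adjacent to each other and to `h`, neither joined to `l` — a CORE PAIR
  (both are cores at the colouring `h–3` red, `h–4` blue, `3–4` blue, `4–5` red, `5–0` red), outside
  every junction theorem of record; `5` is joined to `l`.  `IsHMarkAt.swAll_of_hMark_l` settles it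
  outright (`swAll_ex6h`).
* `ex6p` (`Fin 6`, 8 edges; `l = 0`, `h = 4`, `o = 1`): the mark is joined to `h` and to `p = 5`;
  `2, 3, 5` form with `h` a structure no theorem of record settles with the mark at `1` (`5` is
  joined to `h`, `3` and the mark but not to `l`); with the edges at the mark deleted
  (`isolate ex6p 1 = ex6p'`, a concrete graph) and the mark at `5`, every other vertex has an
  edge to `l` or no edge, so `swAll_of_bridges` applies, and `IsHMarkAt.swAll_hMark` gives the row
  with the mark at `1` (`swAll_ex6p`).
-/

namespace Summit.Ventures.PercRepro2

namespace LocRows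

open Hull

/-- The core-pair instance: `l = 0`, `h = 1`, the mark `2` joined to `l` and `h` only, the
adjacent junctions `3, 4` both joined to `h`, their common neighbour `5` joined to `l`. -/
def ex6h : Fin 8 → Sym2 (Fin 6)
  | 0 => s(2, 0) | 1 => s(2, 1) | 2 => s(1, 3) | 3 => s(1, 4) | 4 => s(3, 4) | 5 => s(3, 5)
  | 6 => s(4, 5) | 7 => s(5, 0)

/-- The mark `2` of `ex6h` is an H-mark vertex relative to `l = 0`. -/
theorem ex6h_hMark : IsHMarkAt ex6h 2 0 1 where
  xp := by decide
  xh := by decide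
  edges := by decide

/-- **Row 2′SW-ALL on the core-pair instance**, outright. -/
theorem swAll_ex6h : SwAll ex6h 0 1 2 := ex6h_hMark.swAll_of_hMark_l (by decide)

/-- Row (SW) on the core-pair instance. -/
theorem sw_ex6h : Sw ex6h 0 1 2 := sw_of_swAll ex6h swAll_ex6h

/-- The second instance: `l = 0`, `h = 4`, the mark `1` joined to `h` and to `p = 5`. -/
def ex6p : Fin 8 → Sym2 (Fin 6)
  | 0 => s(0, 2) | 1 => s(0, 3) | 2 => s(1, 4) | 3 => s(1, 5) | 4 => s(2, 3) | 5 => s(2, 4)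
  | 6 => s(3, 5) | 7 => s(4, 5)

/-- `ex6p` with the edges at the mark deleted (loops at `1`). -/
def ex6p' : Fin 8 → Sym2 (Fin 6)
  | 0 => s(0, 2) | 1 => s(0, 3) | 2 => s(1, 1) | 3 => s(1, 1) | 4 => s(2, 3) | 5 => s(2, 4)
  | 6 => s(3, 5) | 7 => s(4, 5)

/-- The isolated graph of `ex6p` at the mark is `ex6p'`. -/
theorem isolate_ex6p : isolate ex6p 1 = ex6p' := by
  funext e
  fin_cases e <;> simp [isolate, ex6p, ex6p', Sym2.mem_iff]

/-- The mark `1` of `ex6p` is an H-mark vertex relative to `p = 5`. -/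
theorem ex6p_hMark : IsHMarkAt ex6p 1 5 4 where
  xp := by decide
  xh := by decide
  edges := by decide

/-- Row 2′SW-ALL on the isolated graph of `ex6p` with the mark at `5`: the vertices `2, 3` have an
edge to `l = 0`, the isolated mark `1` (loops only) is in no cluster of `h` (`swAll_of_bridges`). -/
theorem swAll_isolate_ex6p : SwAll (isolate ex6p 1) 0 4 5 := by
  refine swAll_of_bridges (by decide) (by rw [isolate_ex6p]; decide) ?_
  have key : ∀ x : Fin 6, x ≠ 0 → x ≠ 4 → x ≠ 5 → x ≠ 1 → ∃ e, ex6p' e = s(x, 0) := by decide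
  intro x hx0 hx4 hx5
  by_cases hx1 : x = 1
  · subst hx1
    exact Or.inr (Or.inr ⟨0, x_notMem_cluster_isolate (by decide)⟩)
  · left
    rw [isolate_ex6p]
    exact key x hx0 hx4 hx5 hx1

/-- **Row 2′SW-ALL on `ex6p` with the mark at `1`** by the H-mark step. -/
theorem swAll_ex6p : SwAll ex6p 0 4 1 := ex6p_hMark.swAll_hMark (by decide) swAll_isolate_ex6p

/-- Row (SW) on `ex6p` with the mark at `1`. -/
theorem sw_ex6p : Sw ex6p 0 4 1 := sw_of_swAll ex6p swAll_ex6p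

end LocRows

end Summit.Ventures.PercRepro2
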